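import Literature.Computability.QuantumComplexity.OracleWalkMachine
import Literature.Computability.QuantumComplexity.BQPRelSubsetAWPPRel
import Literature.Computability.QuantumComplexity.BQPSubsetPP
import Literature.Computability.Complexity.TruthTableClosure
import Literature.Computability.Complexity.CountingProofs
import HarnessLib

/-!
# `accGap ∈ GapP^A`: the query generator, the two relations, and the count — `BQP^A ⊆ AWPP^A` discharged

Final part of the proof of the named fact
`Literature.Computability.QuantumComplexity.BQPRel_subset_AWPPRel` (`CountingSimulationRel.lean`;
Fortnow–Rogers 1999, Thm. 3.1 with Lemma 3.2 and "Theorem 3.1 relativizes", §3: `BQP^A ⊆ AWPP^A`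
for every oracle `A`; at the empty oracle once more `BQP_subset_AWPP`, `CountingSimulation.lean`,
whose discharge `BQP_subset_AWPP_holds` the tree already holds by another route,
`BQPSubsetAWPP.lean`), through the reduction `BQPRel_subset_AWPPRel_of_accGap` /
`BQP_subset_AWPP_of_accGap` of `BQPRelSubsetAWPPRel.lean` to the single counting statement
**`accGap_mem_GapPRel`**: for a uniform Clifford+`T` family `F`, an
oracle `A` and a polynomial `p`, the dyadic numerator `accGap F A p` of the acceptance probability
is a `GapP^A` function. Continues `OracleWalk.lean` (spec and counting identities) and
`OracleWalkMachine.lean` (the walk `passW` as an `FP` string function).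

The two `#P^A` functions are witness counts of the languages `relW F p s A` (`s` = sign), each a
polynomial-time TRUTH-TABLE reduction to `A` (`TTClosure.ttLang`, `ttLang_mem_PRel`): on
`z = ⟨x, u y₁ y₂ pad⟩` (`u` a counter block of `p(|x|) + 1` bits, `y₁, y₂` the coin streams of the
two walks — per gate a choice bit and a guessed answer bit —, `pad` forced to `0`), the query
generator `qryW F p ⟨z, 1ⁱ⟩ ∈ FP` answers with the query of the `i`-th oracle-gate crossing of the
two guessed walks (`qryW_apply`), and the evaluator `dLang F p s ∈ P` re-walks both paths on the
oracle's answer bits and accepts iff every guess was the oracle's answer, both walks are valid and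
end at the same accepting label, the phase-difference class `d` is accepted for the sign `s`
(`clsAcc`), and `u` passes the multiplicity test of `d` (`uTest`: `2^{k+1}` values for the integer
part, `⌊2^k√2⌋` for the `√2/2`-part, `k + 1 = p(|x|) ∸ (h + 1) + 1`). By `sum_gCons` (one
consistent guess vector per choice vector), `cnt_uTest` and `sum_pairTerm_sub`, the difference of
the two counts is `dyadicGap A_S B_S k = accGap F A p x` (`count_relW`, `accGap_eq_sub`).

Main results: `qryW_mem_FP`, `dLang_mem_P`, `relW_mem_PRel`, `mem_relW_iff`, `count_relW`,
**`accGap_mem_GapPRel`**, **`BQPRel_subset_AWPPRel_holds`**, `BQP_subset_AWPP_via_oracleWalk`.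

## References

* L. Fortnow, J. Rogers, *Complexity limitations on quantum computation*, J. Comput. System Sci.
  59 (1999) 240–252 (arXiv:cs/9811023): Lemma 3.2, Thm. 3.1, §3 p. 5 ("Theorem 3.1
  relativizes"), Cor. 3.7.
* L. M. Adleman, J. DeMarrais, M.-D. A. Huang, *Quantum computability*, SIAM J. Comput. 26 (1997),
  §6 Lemma 6.10 (pairs of paths).
* S. Fenner, *PP-lowness and a simple definition of AWPP*, Theory Comput. Syst. 36 (2003),
  Thm. 1.2 (one `GapP` function, dyadic denominators).
* R. E. Ladner, N. A. Lynch, A. L. Selman, *A comparison of polynomial time reducibilities*,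
  Theoret. Comput. Sci. 1 (1975), §3 (truth-table reducibility).
-/

noncomputable section

namespace Literature.Computability.QuantumComplexity

namespace ADH

open _root_.Computability Polynomial Complexity Complexity.Brick Complexity.Plumb Cryptography Complexity.Classes
  Complexity.TTClosure SqrtTwoDyadic

attribute [-simp] Brick.nthF_zero Brick.sndPow_zero

variable {N : ℕ}

/-! ### Only the first `2μ` coins matter -/

/-- The guessed walk reads only the first `2μ` coins. [folklore] -/
theorem gRun_append (gs : List (QGate cliffordT N)) : ∀ (cs rest : List Bool) (s : TState N), 2 * gs.length ≤ cs.length →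
    gRun gs (cs ++ rest) s = gRun gs cs s := by
  induction gs with
  | nil => intro cs rest s _; rfl
  | cons g gs ih =>
    intro cs rest s h
    rcases cs with _ | ⟨c, _ | ⟨a, cs⟩⟩
    · simp at h
    · simp at h; omega
    · simp only [List.length_cons] at h
      simp only [gRun, List.cons_append, headBit_cons, List.tail_cons, List.drop_succ_cons, List.drop_zero]
      exact ih cs rest _ (by omega)

/-- Consistency reads only the first `2μ` coins. [folklore] -/
theorem gCons_append (A : Language Bool) (gs : List (QGate cliffordT N)) : ∀ (cs rest : List Bool) (s : TState N),
    2 * gs.length ≤ cs.length → gCons A gs (cs ++ rest) s = gCons A gs cs s := by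
  induction gs with
  | nil => intro cs rest s _; rfl
  | cons g gs ih =>
    intro cs rest s h
    rcases cs with _ | ⟨c, _ | ⟨a, cs⟩⟩
    · simp at h
    · simp at h; omega
    · simp only [List.length_cons] at h
      simp only [gCons, List.cons_append, headBit_cons, List.tail_cons, List.drop_succ_cons, List.drop_zero]
      rw [ih cs rest _ (by omega)]

/-- The queries read only the first `2μ` coins. [folklore] -/
theorem gQrys_append (gs : List (QGate cliffordT N)) : ∀ (cs rest : List Bool) (s : TState N), 2 * gs.length ≤ cs.length →
    gQrys gs (cs ++ rest) s = gQrys gs cs s := by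
  induction gs with
  | nil => intro cs rest s _; rfl
  | cons g gs ih =>
    intro cs rest s h
    rcases cs with _ | ⟨c, _ | ⟨a, cs⟩⟩
    · simp at h
    · simp at h; omega
    · simp only [List.length_cons] at h
      simp only [gQrys, List.cons_append, headBit_cons, List.tail_cons, List.drop_succ_cons, List.drop_zero]
      rw [ih cs rest _ (by omega)]

/-- `gConsE` reads only the first `μ` answer bits. [folklore] -/
theorem gConsE_append (gs : List (QGate cliffordT N)) : ∀ (cs es rest : List Bool) (s : TState N), gs.length ≤ es.length →
    gConsE gs cs (es ++ rest) s = gConsE gs cs es s := by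
  induction gs with
  | nil => intro cs es rest s _; rfl
  | cons g gs ih =>
    intro cs es rest s h
    rcases es with _ | ⟨b, es⟩
    · simp at h
    · simp only [List.length_cons] at h
      simp only [gConsE, List.cons_append, headBit_cons, List.tail_cons]
      rw [ih _ es rest _ (by omega)]

/-! ### Parsing the input `⟨⟨x, w⟩, extra⟩` and laying out the two walks -/

section Layout

variable (F : QCircuitFamily cliffordT) (p : Polynomial ℕ)

/-- The input `x`, from `⟨⟨x, w⟩, extra⟩`. [folklore] -/
def xP : List Bool → List Bool := fstF ∘ fstF
/-- The witness `w = u y`, from `⟨⟨x, w⟩, extra⟩`. [folklore] -/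
def wwP : List Bool → List Bool := sndF ∘ fstF
/-- The extra argument (`1ⁱ` for the query generator, the answer bits for the evaluator). [folklore] -/
def exP : List Bool → List Bool := sndF
/-- The ruler `1^{p(|x|)+1}` of the counter block. [folklore] -/
def rulP : List Bool → List Bool := polyFn (p + 1) ∘ xP
/-- The counter block `u = w ↾ (p(|x|)+1)`. [folklore] -/
def uP : List Bool → List Bool := takeFn ∘ pr (rulP p) wwP
/-- The coin streams `y = w ⇂ (p(|x|)+1)`. [folklore] -/
def yP : List Bool → List Bool := dropFn ∘ pr (rulP p) wwP
/-- The description of the `|x|`-th circuit. [folklore] -/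
def descP : List Bool → List Bool := F.descFn ∘ xP
/-- The gate codes. [folklore] -/
def codesP : List Bool → List Bool := sndF ∘ sndF ∘ descP F
/-- The ancilla count `1^m`. [folklore] -/
def onesMP : List Bool → List Bool := fstF ∘ sndF ∘ descP F
/-- The padded input label `x 0^m`. [folklore] -/
def w0P : List Bool → List Bool := OracleCompose.concatFn ∘ pr xP (Kannan.zerosFn ∘ onesMP F)

/-- **The record of the first walk**, with answer field `anf` and countdown `cdf` read off the input:
all gates ahead, coins `y`, phase `0`, valid, consistent, counter `0`, unwritten, empty output. [folklore] -/
def rec1W (anf cdf : List Bool → List Bool) : List Bool → List Bool :=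
  mkW (descP F) (codesP F) (yP p) (w0P F) (fun _ => []) (fun _ => [true]) anf (fun _ => [true]) (fun _ => [])
    cdf (fun _ => [false]) (fun _ => [])
/-- The input together with the result of the first walk. [folklore] -/
def st1W (anf cdf : List Bool → List Bool) : List Bool → List Bool := pr id (passW ∘ rec1W F p anf cdf)
/-- **The record of the second walk** on `⟨input, R₁⟩`: gates ahead again, the coins the first walk
left, fresh core, and the answers, consistency bit, countdown, flag and output CARRIED OVER. [folklore] -/
def rec2W : List Bool → List Bool :=
  mkW (descP F ∘ fstF) (codesP F ∘ fstF) (coF ∘ sndF) (w0P F ∘ fstF) (fun _ => []) (fun _ => [true]) (anF ∘ sndF)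
    (okF ∘ sndF) (fun _ => []) (cdF ∘ sndF) (flF ∘ sndF) (outF ∘ sndF)
/-- Both walks: `input ↦ ⟨⟨input, R₁⟩, R₂⟩`. [cite: AdlemanDeMarraisHuang1997, §6 Lemma 6.10 (proof, step 3: two paths)] -/
def st2W (anf cdf : List Bool → List Bool) : List Bool → List Bool := pr id (passW ∘ rec2W F) ∘ st1W F p anf cdf

variable {F}

/-- `descP F ∈ FP` for a uniform family. [folklore] -/
theorem descP_mem_FP (hU : F.IsUniform) : descP F ∈ FP :=
  comp_mem_FP (QCircuitFamily.descFn_mem_FP_of_isUniform hU) (comp_mem_FP fstF_mem_FP fstF_mem_FP)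
/-- `codesP F ∈ FP`. [folklore] -/
theorem codesP_mem_FP (hU : F.IsUniform) : codesP F ∈ FP := comp_mem_FP sndF_mem_FP (comp_mem_FP sndF_mem_FP (descP_mem_FP hU))
/-- `w0P F ∈ FP`. [folklore] -/
theorem w0P_mem_FP (hU : F.IsUniform) : w0P F ∈ FP :=
  comp_mem_FP OracleCompose.concatFn_mem_FP (fanoutFn_mem_FP (comp_mem_FP fstF_mem_FP fstF_mem_FP)
    (comp_mem_FP Kannan.zerosFn_mem_FP (comp_mem_FP fstF_mem_FP (comp_mem_FP sndF_mem_FP (descP_mem_FP hU)))))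
/-- `yP p ∈ FP`. [folklore] -/
theorem yP_mem_FP : yP p ∈ FP :=
  comp_mem_FP dropFn_mem_FP (fanoutFn_mem_FP (comp_mem_FP (polyFn_mem_FP _) (comp_mem_FP fstF_mem_FP fstF_mem_FP))
    (comp_mem_FP sndF_mem_FP fstF_mem_FP))
/-- `uP p ∈ FP`. [folklore] -/
theorem uP_mem_FP : uP p ∈ FP :=
  comp_mem_FP takeFn_mem_FP (fanoutFn_mem_FP (comp_mem_FP (polyFn_mem_FP _) (comp_mem_FP fstF_mem_FP fstF_mem_FP))
    (comp_mem_FP sndF_mem_FP fstF_mem_FP))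
/-- `rec1W … ∈ FP`. [folklore] -/
theorem rec1W_mem_FP (hU : F.IsUniform) {anf cdf : List Bool → List Bool} (ha : anf ∈ FP) (hc : cdf ∈ FP) :
    rec1W F p anf cdf ∈ FP :=
  mkW_mem_FP (descP_mem_FP hU) (codesP_mem_FP hU) (yP_mem_FP p) (w0P_mem_FP hU) (const_mem_FP _) (const_mem_FP _) ha
    (const_mem_FP _) (const_mem_FP _) hc (const_mem_FP _) (const_mem_FP _)
/-- `st1W … ∈ FP`. [folklore] -/
theorem st1W_mem_FP (hU : F.IsUniform) {anf cdf : List Bool → List Bool} (ha : anf ∈ FP) (hc : cdf ∈ FP) :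
    st1W F p anf cdf ∈ FP :=
  fanoutFn_mem_FP OracleCompose.id_mem_FP (comp_mem_FP passW_mem_FP (rec1W_mem_FP p hU ha hc))
/-- `rec2W … ∈ FP`. [folklore] -/
theorem rec2W_mem_FP (hU : F.IsUniform) : rec2W F ∈ FP :=
  mkW_mem_FP (comp_mem_FP (descP_mem_FP hU) fstF_mem_FP) (comp_mem_FP (codesP_mem_FP hU) fstF_mem_FP)
    (comp_mem_FP (nthF_mem_FP 2) sndF_mem_FP) (comp_mem_FP (w0P_mem_FP hU) fstF_mem_FP) (const_mem_FP _) (const_mem_FP _)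
    (comp_mem_FP (nthF_mem_FP 6) sndF_mem_FP) (comp_mem_FP (nthF_mem_FP 7) sndF_mem_FP) (const_mem_FP _)
    (comp_mem_FP (nthF_mem_FP 9) sndF_mem_FP) (comp_mem_FP (nthF_mem_FP 10) sndF_mem_FP) (comp_mem_FP (sndPow_mem_FP 10) sndF_mem_FP)
/-- `st2W … ∈ FP`. [folklore] -/
theorem st2W_mem_FP (hU : F.IsUniform) {anf cdf : List Bool → List Bool} (ha : anf ∈ FP) (hc : cdf ∈ FP) :
    st2W F p anf cdf ∈ FP :=
  comp_mem_FP (fanoutFn_mem_FP OracleCompose.id_mem_FP (comp_mem_FP passW_mem_FP (rec2W_mem_FP hU))) (st1W_mem_FP p hU ha hc)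

variable (F) (x w ex : List Bool)

/-- The number of counter bits: `K = p(|x|) + 1`. [folklore] -/
def Kx : ℕ := p.eval x.length + 1

/-- **The first machine state**: input label, phase `0`, valid, answers `an`, consistent, counter `0`,
countdown `cd`, unwritten, empty output. [folklore] -/
def m1 (an cd : List Bool) : MS (x.length + F.ancillas x.length) := ⟨(w₀ F x, 0, true), an, true, 0, cd, false, []⟩

/-- **The second machine state**: fresh core, everything else carried over from `M`. [folklore] -/
def m2 (M : MS (x.length + F.ancillas x.length)) : MS (x.length + F.ancillas x.length) :=
  ⟨(w₀ F x, 0, true), M.an, M.ok, 0, M.cd, M.fl, M.out⟩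

/-- The parsed pieces of the input `⟨⟨x, w⟩, extra⟩`. [folklore] -/
theorem parse_apply :
    xP (boolPair (boolPair x w) ex) = x ∧ wwP (boolPair (boolPair x w) ex) = w ∧ exP (boolPair (boolPair x w) ex) = ex ∧
      uP p (boolPair (boolPair x w) ex) = w.take (Kx p x) ∧ yP p (boolPair (boolPair x w) ex) = w.drop (Kx p x) ∧
      descP F (boolPair (boolPair x w) ex) = F.descFn x ∧ codesP F (boolPair (boolPair x w) ex) = encList (codes F x) ∧
      w0P F (boolPair (boolPair x w) ex) = List.ofFn (w₀ F x) := by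
  refine ⟨by simp [xP, fstF], by simp [wwP, fstF, sndF], by simp [exP, sndF], ?_, ?_, by simp [descP, xP, fstF], ?_, ?_⟩
  · simp [uP, rulP, wwP, xP, fstF, sndF, Kx]
  · simp [yP, rulP, wwP, xP, fstF, sndF, Kx]
  · simp [codesP, descP, xP, descFn_eq, fstF, sndF]
  · simp [w0P, onesMP, descP, xP, descFn_eq, w₀, ofFn_padInput, fstF, sndF]

/-- **The first record on the input.** [folklore] -/
theorem rec1W_apply (anf cdf : List Bool → List Bool) :
    rec1W F p anf cdf (boolPair (boolPair x w) ex) =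
      recOf (F.descFn x) (encList (codes F x)) (w.drop (Kx p x))
        (m1 F x (anf (boolPair (boolPair x w) ex)) (cdf (boolPair (boolPair x w) ex))) := by
  obtain ⟨-, -, -, -, hy, hd, hc, hw0⟩ := parse_apply F p x w ex
  rw [rec1W, mkW_apply, hy, hd, hc, hw0, recOf_eq]
  rfl

/-- **The first walk on the input.** [cite: AdlemanDeMarraisHuang1997, §6 Lemma 6.10 (proof, step 3)] -/
theorem st1W_apply (anf cdf : List Bool → List Bool) :
    st1W F p anf cdf (boolPair (boolPair x w) ex) =
      boolPair (boolPair (boolPair x w) ex)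
        (recOf (F.descFn x) [] ((w.drop (Kx p x)).drop (2 * (F.circ x.length).gates.length))
          (mRun (F.circ x.length).gates (w.drop (Kx p x))
            (m1 F x (anf (boolPair (boolPair x w) ex)) (cdf (boolPair (boolPair x w) ex))))) := by
  show fanoutFn id (passW ∘ rec1W F p anf cdf) (boolPair (boolPair x w) ex) = _
  rw [fanoutFn_apply, id, Function.comp_apply, rec1W_apply, passW_recOf]
  exact congrArg _ (iterate_roundW _ _ _ _ _ (length_gates_le_length_descFn F x))

/-- **The second record** on `⟨input, R₁⟩`. [folklore] -/
theorem rec2W_apply (co : List Bool) (M : MS (x.length + F.ancillas x.length)) :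
    rec2W F (boolPair (boolPair (boolPair x w) ex) (recOf (F.descFn x) [] co M)) =
      recOf (F.descFn x) (encList (codes F x)) co (m2 F x M) := by
  obtain ⟨-, -, -, -, -, hd, hc, hw0⟩ := parse_apply F 0 x w ex
  obtain ⟨-, -, hco, -, -, -, han, hok, -, hcd, hfl, hout⟩ := fields_recOf (F.descFn x) [] co M
  rw [rec2W, mkW_apply]
  simp only [Function.comp_apply, fstF_boolPair, sndF_boolPair, hd, hc, hw0, hco, han, hok, hcd, hfl, hout]
  rw [recOf_eq]
  rfl

/-- **Both walks on the input**: `⟨⟨input, R₁⟩, R₂⟩` with `R₁` the record of the first machine walk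
on the coins `y = w ⇂ K` and `R₂` that of the second on the coins `y ⇂ 2μ`, everything but the core
carried over. [cite: AdlemanDeMarraisHuang1997, §6 Lemma 6.10 (proof, step 3)] -/
theorem st2W_apply (anf cdf : List Bool → List Bool) :
    st2W F p anf cdf (boolPair (boolPair x w) ex) =
      (let gs := (F.circ x.length).gates
       let y := w.drop (Kx p x)
       let M₁ := mRun gs y (m1 F x (anf (boolPair (boolPair x w) ex)) (cdf (boolPair (boolPair x w) ex)))
       let M₂ := mRun gs (y.drop (2 * gs.length)) (m2 F x M₁)
       boolPair (boolPair (boolPair (boolPair x w) ex) (recOf (F.descFn x) [] (y.drop (2 * gs.length)) M₁))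
         (recOf (F.descFn x) [] ((y.drop (2 * gs.length)).drop (2 * gs.length)) M₂)) := by
  show fanoutFn id (passW ∘ rec2W F) (st1W F p anf cdf (boolPair (boolPair x w) ex)) = _
  rw [fanoutFn_apply, id, st1W_apply, Function.comp_apply, rec2W_apply, passW_recOf]
  exact congrArg _ (iterate_roundW _ _ _ _ _ (length_gates_le_length_descFn F x))

end Layout

/-! ### The query generator -/

section Query

variable (F : QCircuitFamily cliffordT) (p : Polynomial ℕ)

/-- **The query generator**: on `⟨z, 1ⁱ⟩`, both walks with countdown `1ⁱ` and no answers; the output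
register of the second record. [cite: LadnerLynchSelman1975, §3] -/
def qryW : List Bool → List Bool := outF ∘ sndF ∘ st2W F p (fun _ => []) exP

variable {F} in
/-- **`qryW F p ∈ FP`** for a uniform family. [cite: AroraBarak2009, §1.3] -/
theorem qryW_mem_FP (hU : F.IsUniform) : qryW F p ∈ FP :=
  comp_mem_FP (sndPow_mem_FP 10) (comp_mem_FP sndF_mem_FP (st2W_mem_FP p hU (const_mem_FP _) sndF_mem_FP))

/-- Item `i` of a list of queries (`ε` beyond its end). [folklore] -/
def nthQ (qs : List (List Bool)) (i : ℕ) : List Bool := if h : i < qs.length then qs[i] else []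

variable (x : List Bool)

/-- **The query sequence of the two guessed walks** on the coins `y`: the queries along the first
walk, then those along the second (on `y ⇂ 2μ`), then `ε`. [folklore] -/
def qSeq (y : List Bool) (i : ℕ) : List Bool :=
  if i < (F.circ x.length).gates.length then nthQ (gQrys (F.circ x.length).gates y (w₀ F x, 0, true)) i
  else nthQ (gQrys (F.circ x.length).gates (y.drop (2 * (F.circ x.length).gates.length)) (w₀ F x, 0, true))
    (i - (F.circ x.length).gates.length)

/-- **Value of the query generator**: `qryW F p ⟨⟨x, w⟩, 1ⁱ⟩ = qSeq F x (w ⇂ K) i`.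
[cite: FortnowRogers1999JCSS, §3 ("Theorem 3.1 relativizes")] -/
theorem qryW_apply (w : List Bool) (i : ℕ) : qryW F p (boolPair (boolPair x w) (ones i)) = qSeq F x (w.drop (Kx p x)) i := by
  have h2 := st2W_apply F p x w (ones i) (fun _ => []) exP
  obtain ⟨-, -, hex, -⟩ := parse_apply F p x w (ones i)
  rw [hex] at h2
  simp only [qryW, Function.comp_apply, h2, sndF_boolPair]
  rw [(fields_recOf _ _ _ _).2.2.2.2.2.2.2.2.2.2.2]
  unfold qSeq nthQ
  generalize (F.circ x.length).gates = gs
  generalize w.drop (Kx p x) = y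
  have hfl1 : (mRun gs y (m1 F x [] (ones i))).fl = decide (i < gs.length) := by rw [mRun_fl]; simp [m1, ones]
  have hout1 : (mRun gs y (m1 F x [] (ones i))).out =
      if h : i < gs.length then (gQrys gs y (w₀ F x, 0, true))[i]'(by simpa using h) else [] := by
    rw [mRun_out gs y _ rfl]; simp [m1, ones]
  have hcd1 : (mRun gs y (m1 F x [] (ones i))).cd = ones (i - gs.length) := by rw [mRun_cd]; simp [m1, ones]
  by_cases hi : i < gs.length
  · rw [(mRun_out_of_fl gs _ (m2 F x (mRun gs y (m1 F x [] (ones i)))) (by simp [m2, hfl1, hi])).1]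
    simp only [m2, hout1, dif_pos hi, if_pos hi, length_gQrys]
  · rw [mRun_out gs _ (m2 F x (mRun gs y (m1 F x [] (ones i)))) (by simp [m2, hfl1, hi])]
    simp only [m2, hcd1, length_ones, hout1, dif_neg hi, if_neg hi, length_gQrys]

/-- **The oracle's answers to the query generator**: the first `μ` are the answers to the queries of
the first walk, the next `μ` those of the second. [folklore] -/
theorem ttBits_qryW (A : Language Bool) (w : List Bool) {n : ℕ} (hn : 2 * (F.circ x.length).gates.length ≤ n) :
    ∃ rest : List Bool, ttBits (qryW F p) A (boolPair x w) n =
      (gQrys (F.circ x.length).gates (w.drop (Kx p x)) (w₀ F x, 0, true)).map A.boolIndicator ++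
        ((gQrys (F.circ x.length).gates ((w.drop (Kx p x)).drop (2 * (F.circ x.length).gates.length)) (w₀ F x, 0, true)).map
          A.boolIndicator ++ rest) := by
  have hget : ∀ (i : ℕ) (h : i < (ttBits (qryW F p) A (boolPair x w) n).length),
      (ttBits (qryW F p) A (boolPair x w) n)[i] = A.boolIndicator (qSeq F x (w.drop (Kx p x)) i) := by
    intro i h
    simp only [ttBits, List.getElem_map, List.getElem_range]
    rw [← qryW_apply]
  have hlen : (ttBits (qryW F p) A (boolPair x w) n).length = n := by simp
  generalize ttBits (qryW F p) A (boolPair x w) n = es at hget hlen ⊢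
  unfold qSeq nthQ at hget
  generalize (F.circ x.length).gates = gs at hget hn ⊢
  generalize w.drop (Kx p x) = y at hget ⊢
  refine ⟨es.drop (2 * gs.length), ?_⟩
  rw [← List.append_assoc]
  conv_lhs => rw [← List.take_append_drop (2 * gs.length) es]
  congr 1
  apply List.ext_getElem
  · simp only [List.length_take, List.length_append, List.length_map, length_gQrys, hlen]; omega
  · intro i h1 h2
    rw [List.getElem_take, hget]
    simp only [List.length_append, List.length_map, length_gQrys] at h2
    by_cases hi : i < gs.length
    · rw [List.getElem_append_left (by simpa using hi), List.getElem_map, if_pos hi, dif_pos (by simpa using hi)]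
    · have hi' : i - gs.length < gs.length := by omega
      rw [List.getElem_append_right (by simpa using hi), List.getElem_map, if_neg hi, dif_pos (by simpa using hi')]
      simp only [List.length_map, length_gQrys]

end Query

/-! ### The evaluator -/

section Verdict

variable (p : Polynomial ℕ)

/-- The first record `R₁`, from `⟨⟨input, R₁⟩, R₂⟩`. [folklore] -/
def r1P : List Bool → List Bool := sndF ∘ fstF
/-- The second record `R₂`. [folklore] -/
def r2P : List Bool → List Bool := sndF
/-- The input, from `⟨⟨input, R₁⟩, R₂⟩`. [folklore] -/
def inP : List Bool → List Bool := fstF ∘ fstF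
/-- The pair `⟨R₁, R₂⟩` (the argument shape of `ADH.diffF`). [folklore] -/
def pairRR : List Bool → List Bool := pr r1P r2P
/-- The one-bit test "contains a `1`". [folklore] -/
def hasTrueFn : List Bool → List Bool := (hasBitT true).eval
/-- The padding coins (left by the second walk) are all `0`. [folklore] -/
def padT : List Bool → List Bool := notFn (hasTrueFn ∘ coF ∘ r2P)
/-- Every guess was the oracle's answer (consistency bit after both walks). [folklore] -/
def ok2T : List Bool → List Bool := eqC [true] (okF ∘ r2P)
/-- The first walk is valid. [folklore] -/
def vb1T : List Bool → List Bool := eqC [true] (vbF ∘ r1P)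
/-- The second walk is valid. [folklore] -/
def vb2T : List Bool → List Bool := eqC [true] (vbF ∘ r2P)
/-- Both walks end at the same label. [cite: AdlemanDeMarraisHuang1997, §6 Lemma 6.10 (proof, step 4)] -/
def labT : List Bool → List Bool := eqPairFn ∘ pr (wF ∘ r1P) (wF ∘ r2P)
/-- The common label is accepting (wire `0` reads `1`). [cite: AdlemanDeMarraisHuang1997, §6 Lemma 6.10 (proof, step 5)] -/
def accT : List Bool → List Bool := bitT (wF ∘ r1P)
/-- "The phase-difference class is `j`". [folklore] -/
def isDT (j : ℕ) : List Bool → List Bool := isD j ∘ pairRR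
/-- **The accepted classes of sign `s`**: `{0, 1, 7}` for `s = 1`, `{3, 4, 5}` for `s = 0` (`clsAcc`). [cite: FortnowRogers1999JCSS, Lemma 3.2 (arXiv numbering)] -/
def clsT (s : Bool) : List Bool → List Bool :=
  if s then orFn (isDT 0) (orFn (isDT 1) (isDT 7)) else orFn (isDT 3) (orFn (isDT 4) (isDT 5))
/-- The class is odd (the `√2/2`-part). [folklore] -/
def oddT : List Bool → List Bool := orFn (isDT 1) (orFn (isDT 3) (orFn (isDT 5) (isDT 7)))
/-- `1^{k+1}` with `k + 1 = (p(|x|) ∸ (h + 1)) + 1`, `h` the Hadamard count of the first walk. [folklore] -/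
def k1T : List Bool → List Bool :=
  OracleCompose.concatFn ∘ pr (dropFn ∘ pr (hh1F ∘ r1P) (polyFn p ∘ xP ∘ inP)) (fun _ => [true])
/-- The counter block `u`. [folklore] -/
def ucP : List Bool → List Bool := uP p ∘ inP
/-- The even test: no `1` in `u` from bit `k + 1` on. [folklore] -/
def evenU : List Bool → List Bool := notFn (hasTrueFn ∘ dropFn ∘ pr (k1T p) (ucP p))
/-- The numeral `0^{2k+1} 1` of `2 · 4^k`. [folklore] -/
def numF : List Bool → List Bool :=
  OracleCompose.concatFn ∘ pr (Kannan.zerosFn ∘ List.tail ∘ OracleCompose.concatFn ∘ pr (k1T p) (k1T p)) (fun _ => [true])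
/-- `⟦u⟧ + 1`. [folklore] -/
def u1F : List Bool → List Bool := addFn ∘ pr (ucP p) (fun _ => [true])
/-- The odd test: `(⟦u⟧ + 1)² ≤ 2 · 4^k`. [folklore] -/
def oddU : List Bool → List Bool := notFn (ltFn ∘ pr (numF p) (prodFn ∘ pr (u1F p) (u1F p)))
/-- The multiplicity test of the class. [folklore] -/
def uTT : List Bool → List Bool := iteFn oddT (oddU p) (evenU p)

/-- **The verdict of sign `s`** on `⟨⟨input, R₁⟩, R₂⟩`. [cite: FortnowRogers1999JCSS, Lemma 3.2 and Thm. 3.1 (arXiv numbering)] -/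
def verdictW (s : Bool) : List Bool → List Bool :=
  andFn padT (andFn ok2T (andFn vb1T (andFn vb2T (andFn labT (andFn accT (andFn (clsT s) (uTT p)))))))

/-- `hasTrueFn ∈ FP`. [folklore] -/
theorem hasTrueFn_mem_FP : hasTrueFn ∈ FP := (hasBitT true).polyTimeComputable_eval
/-- Value of `hasTrueFn`. [folklore] -/
theorem hasTrueFn_apply (w : List Bool) : hasTrueFn w = [decide (true ∈ w)] := hasBitT_eval true w
/-- `isDT j ∈ FP`. [folklore] -/
theorem isDT_mem_FP (j : ℕ) : isDT j ∈ FP :=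
  comp_mem_FP (isD_mem_FP j) (fanoutFn_mem_FP (comp_mem_FP sndF_mem_FP fstF_mem_FP) sndF_mem_FP)
/-- `clsT s ∈ FP`. [folklore] -/
theorem clsT_mem_FP (s : Bool) : clsT s ∈ FP := by
  unfold clsT; split_ifs
  exacts [orFn_mem_FP (isDT_mem_FP 0) (orFn_mem_FP (isDT_mem_FP 1) (isDT_mem_FP 7)),
    orFn_mem_FP (isDT_mem_FP 3) (orFn_mem_FP (isDT_mem_FP 4) (isDT_mem_FP 5))]
/-- `oddT ∈ FP`. [folklore] -/
theorem oddT_mem_FP : oddT ∈ FP :=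
  orFn_mem_FP (isDT_mem_FP 1) (orFn_mem_FP (isDT_mem_FP 3) (orFn_mem_FP (isDT_mem_FP 5) (isDT_mem_FP 7)))
/-- `k1T p ∈ FP`. [folklore] -/
theorem k1T_mem_FP : k1T p ∈ FP :=
  comp_mem_FP OracleCompose.concatFn_mem_FP (fanoutFn_mem_FP (comp_mem_FP dropFn_mem_FP (fanoutFn_mem_FP
    (comp_mem_FP hh1F_mem_FP (comp_mem_FP sndF_mem_FP fstF_mem_FP))
    (comp_mem_FP (polyFn_mem_FP p) (comp_mem_FP (comp_mem_FP fstF_mem_FP fstF_mem_FP) (comp_mem_FP fstF_mem_FP fstF_mem_FP)))))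
    (const_mem_FP _))
/-- `ucP p ∈ FP`. [folklore] -/
theorem ucP_mem_FP : ucP p ∈ FP := comp_mem_FP (uP_mem_FP p) (comp_mem_FP fstF_mem_FP fstF_mem_FP)
/-- `evenU p ∈ FP`. [folklore] -/
theorem evenU_mem_FP : evenU p ∈ FP :=
  notFn_mem_FP (comp_mem_FP hasTrueFn_mem_FP (comp_mem_FP dropFn_mem_FP (fanoutFn_mem_FP (k1T_mem_FP p) (ucP_mem_FP p))))
/-- `numF p ∈ FP`. [folklore] -/
theorem numF_mem_FP : numF p ∈ FP :=
  comp_mem_FP OracleCompose.concatFn_mem_FP (fanoutFn_mem_FP (comp_mem_FP Kannan.zerosFn_mem_FP (comp_mem_FP PRelSigma.tail_mem_FP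
    (comp_mem_FP OracleCompose.concatFn_mem_FP (fanoutFn_mem_FP (k1T_mem_FP p) (k1T_mem_FP p))))) (const_mem_FP _))
/-- `u1F p ∈ FP`. [folklore] -/
theorem u1F_mem_FP : u1F p ∈ FP := comp_mem_FP addFn_mem_FP (fanoutFn_mem_FP (ucP_mem_FP p) (const_mem_FP _))
/-- `oddU p ∈ FP`. [folklore] -/
theorem oddU_mem_FP : oddU p ∈ FP :=
  notFn_mem_FP (comp_mem_FP ltFn_mem_FP (fanoutFn_mem_FP (numF_mem_FP p) (comp_mem_FP prodFn_mem_FP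
    (fanoutFn_mem_FP (u1F_mem_FP p) (u1F_mem_FP p)))))
/-- `uTT p ∈ FP`. [folklore] -/
theorem uTT_mem_FP : uTT p ∈ FP := iteFn_mem_FP oddT_mem_FP (oddU_mem_FP p) (evenU_mem_FP p)

/-- **`verdictW p s ∈ FP`.** [cite: AroraBarak2009, §1.3] -/
theorem verdictW_mem_FP (s : Bool) : verdictW p s ∈ FP :=
  andFn_mem_FP (notFn_mem_FP (comp_mem_FP hasTrueFn_mem_FP (comp_mem_FP (nthF_mem_FP 2) sndF_mem_FP)))
    (andFn_mem_FP (eqC_mem_FP _ (comp_mem_FP (nthF_mem_FP 7) sndF_mem_FP))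
    (andFn_mem_FP (eqC_mem_FP _ (comp_mem_FP (nthF_mem_FP 5) (comp_mem_FP sndF_mem_FP fstF_mem_FP)))
    (andFn_mem_FP (eqC_mem_FP _ (comp_mem_FP (nthF_mem_FP 5) sndF_mem_FP))
    (andFn_mem_FP (comp_mem_FP eqPairFn_mem_FP (fanoutFn_mem_FP (comp_mem_FP (nthF_mem_FP 3) (comp_mem_FP sndF_mem_FP fstF_mem_FP))
      (comp_mem_FP (nthF_mem_FP 3) sndF_mem_FP)))
    (andFn_mem_FP (bitT_mem_FP (comp_mem_FP (nthF_mem_FP 3) (comp_mem_FP sndF_mem_FP fstF_mem_FP)))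
    (andFn_mem_FP (clsT_mem_FP s) (uTT_mem_FP p)))))))

/-- Every `orFn` of `isDT`s is one-bit. [folklore] -/
theorem oneBit_isDT (j : ℕ) : OneBit (isDT j) := fun T => ⟨_, isD_apply j (pairRR T)⟩

/-- `verdictW p s` is one-bit. [folklore] -/
theorem oneBit_verdictW (s : Bool) : OneBit (verdictW p s) := by
  refine oneBit_andFn (oneBit_notFn fun T => ⟨_, hasTrueFn_apply _⟩) (oneBit_andFn (fun T => ⟨_, eqC_apply _ _ _⟩)
    (oneBit_andFn (fun T => ⟨_, eqC_apply _ _ _⟩) (oneBit_andFn (fun T => ⟨_, eqC_apply _ _ _⟩)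
    (oneBit_andFn (fun T => ⟨decide (wF (r1P T) = wF (r2P T)), by simp [labT, eqPairFn_boolPair]⟩) (oneBit_andFn (fun T => ⟨_, bitT_apply _ _⟩)
    (oneBit_andFn ?_ ((oneBit_orFn (oneBit_isDT 1) (oneBit_orFn (oneBit_isDT 3) (oneBit_orFn (oneBit_isDT 5)
      (oneBit_isDT 7)))).ite (oneBit_notFn (oneBit_ltFn.comp _)) (oneBit_notFn fun T => ⟨_, hasTrueFn_apply _⟩))))))))
  unfold clsT; split_ifs
  exacts [oneBit_orFn (oneBit_isDT 0) (oneBit_orFn (oneBit_isDT 1) (oneBit_isDT 7)),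
    oneBit_orFn (oneBit_isDT 3) (oneBit_orFn (oneBit_isDT 4) (oneBit_isDT 5))]

end Verdict

/-! ### Values of the tests on the pair of final records -/

section VerdictSpec

variable (p : Polynomial ℕ) (F : QCircuitFamily cliffordT) (x w ex : List Bool) (co₁ co₂ : List Bool)
  (M₁ M₂ : MS (x.length + F.ancillas x.length))

/-- The argument of the verdict: `⟨⟨⟨⟨x, w⟩, ex⟩, R₁⟩, R₂⟩`. [folklore] -/
def argT : List Bool :=
  boolPair (boolPair (boolPair (boolPair x w) ex) (recOf (F.descFn x) [] co₁ M₁)) (recOf (F.descFn x) [] co₂ M₂)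

/-- The class register on the pair of final records. [folklore] -/
theorem diffF_pairRR_argT : diffF (pairRR (argT F x w ex co₁ co₂ M₁ M₂)) = ones ((M₁.s.2.1 + 7 * M₂.s.2.1) % 8) := by
  simp only [pairRR, r1P, r2P, argT, fanoutFn_apply, Function.comp_apply, fstF_boolPair, sndF_boolPair, recOf_eq]
  exact diffF_pair _ _ _ _ _ _ _ _ _ _ _ _

/-- Value of `isDT j`. [folklore] -/
theorem isDT_argT (j : ℕ) : isDT j (argT F x w ex co₁ co₂ M₁ M₂) = [decide ((M₁.s.2.1 + 7 * M₂.s.2.1) % 8 = j)] := by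
  rw [isDT, Function.comp_apply, isD_apply, diffF_pairRR_argT]
  simp only [ones_inj]

/-- Value of `clsT s`: the accepted classes `clsAcc s`. [folklore] -/
theorem clsT_argT (s : Bool) : clsT s (argT F x w ex co₁ co₂ M₁ M₂) = [clsAcc s ((M₁.s.2.1 + 7 * M₂.s.2.1) % 8)] := by
  unfold clsT clsAcc
  cases s
  · simp only [Bool.false_eq_true, if_false]
    rw [orFn_apply (isDT_argT F x w ex co₁ co₂ M₁ M₂ 3) (orFn_apply (isDT_argT F x w ex co₁ co₂ M₁ M₂ 4) (isDT_argT F x w ex co₁ co₂ M₁ M₂ 5))]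
    simp [Bool.decide_or]
  · simp only [if_true]
    rw [orFn_apply (isDT_argT F x w ex co₁ co₂ M₁ M₂ 0) (orFn_apply (isDT_argT F x w ex co₁ co₂ M₁ M₂ 1) (isDT_argT F x w ex co₁ co₂ M₁ M₂ 7))]
    simp [Bool.decide_or]

/-- Value of `oddT`: the class is odd. [folklore] -/
theorem oddT_argT : oddT (argT F x w ex co₁ co₂ M₁ M₂) = [decide ((M₁.s.2.1 + 7 * M₂.s.2.1) % 8 % 2 = 1)] := by
  unfold oddT
  rw [orFn_apply (isDT_argT F x w ex co₁ co₂ M₁ M₂ 1) (orFn_apply (isDT_argT F x w ex co₁ co₂ M₁ M₂ 3)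
    (orFn_apply (isDT_argT F x w ex co₁ co₂ M₁ M₂ 5) (isDT_argT F x w ex co₁ co₂ M₁ M₂ 7)))]
  have h8 : (M₁.s.2.1 + 7 * M₂.s.2.1) % 8 < 8 := Nat.mod_lt _ (by norm_num)
  generalize (M₁.s.2.1 + 7 * M₂.s.2.1) % 8 = D at h8 ⊢
  interval_cases D <;> decide

/-- Value of `k1T p`: `1^{k+1}` with `k = p(|x|) ∸ (h₁ + 1)`. [folklore] -/
theorem k1T_argT : k1T p (argT F x w ex co₁ co₂ M₁ M₂) = ones (p.eval x.length - (M₁.hh + 1) + 1) := by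
  obtain ⟨-, -, -, -, -, -, -, -, hhh, -⟩ := fields_recOf (F.descFn x) [] co₁ M₁
  simp only [k1T, argT, inP, r1P, xP, Function.comp_apply, fanoutFn_apply, fstF_boolPair, sndF_boolPair, hh1F_apply, hhh,
    polyFn_apply, dropFn_boolPair, OracleCompose.concatFn_boolPair, List.length_append, length_ones, List.length_singleton]
  simp [ones, List.replicate_succ']

/-- Value of `ucP p`: the counter block. [folklore] -/
theorem ucP_argT : ucP p (argT F x w ex co₁ co₂ M₁ M₂) = w.take (Kx p x) := by
  obtain ⟨-, -, -, hu, -⟩ := parse_apply F p x w ex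
  simp only [ucP, argT, inP, Function.comp_apply, fstF_boolPair, hu]

/-- `2 · 4^k = 2^{2k+1}`. [folklore] -/
theorem two_mul_four_pow (k : ℕ) : 2 * 4 ^ k = 2 ^ (2 * k + 1) := by
  rw [pow_succ, pow_mul]; norm_num; ring

/-- Value of `uTT p`: the multiplicity test `uTest k d u`. [folklore] -/
theorem uTT_argT : uTT p (argT F x w ex co₁ co₂ M₁ M₂) =
    [uTest (p.eval x.length - (M₁.hh + 1)) ((M₁.s.2.1 + 7 * M₂.s.2.1) % 8) (w.take (Kx p x))] := by
  set k := p.eval x.length - (M₁.hh + 1) with hk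
  have hk1 := k1T_argT p F x w ex co₁ co₂ M₁ M₂
  rw [← hk] at hk1
  have hu := ucP_argT p F x w ex co₁ co₂ M₁ M₂
  have heven : evenU p (argT F x w ex co₁ co₂ M₁ M₂) = [!decide (true ∈ (w.take (Kx p x)).drop (k + 1))] := by
    rw [evenU]
    refine notFn_apply ?_
    simp only [Function.comp_apply, fanoutFn_apply, hk1, hu, dropFn_boolPair, length_ones, hasTrueFn_apply]
  have hnum : numF p (argT F x w ex co₁ co₂ M₁ M₂) = List.replicate (2 * k + 1) false ++ [true] := by
    simp only [numF, Function.comp_apply, fanoutFn_apply, hk1, OracleCompose.concatFn_boolPair, Kannan.zerosFn_apply]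
    have e : ((ones (k + 1) ++ ones (k + 1)).tail).length = 2 * k + 1 := by
      simp only [List.length_tail, List.length_append, length_ones]; omega
    rw [e]
  have hu1 : u1F p (argT F x w ex co₁ co₂ M₁ M₂) = encodeNat (bitsToNat (w.take (Kx p x)) + 1) := by
    simp only [u1F, Function.comp_apply, fanoutFn_apply, hu, addFn_boolPair, bitsToNat_cons, bitsToNat_nil, Bool.toNat_true]
  have hval : bitsToNat (List.replicate (2 * k + 1) false ++ [true]) = 2 * 4 ^ k := by
    rw [bitsToNat_append, bitsToNat_replicate_false, List.length_replicate, two_mul_four_pow]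
    simp
  have hodd : oddU p (argT F x w ex co₁ co₂ M₁ M₂) =
      [!decide (2 * 4 ^ k < (bitsToNat (w.take (Kx p x)) + 1) * (bitsToNat (w.take (Kx p x)) + 1))] := by
    rw [oddU]
    refine notFn_apply ?_
    simp only [Function.comp_apply, fanoutFn_apply, hnum, hu1, prodFn_boolPair, ltFn_boolPair, bitsToNat_encodeNat, hval]
  rw [uTT, iteFn_apply (oddT_argT F x w ex co₁ co₂ M₁ M₂), uTest]
  by_cases ho : (M₁.s.2.1 + 7 * M₂.s.2.1) % 8 % 2 = 1
  · simp only [ho, decide_true, if_true, hodd, ← decide_not, not_lt]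
  · simp only [ho, decide_false, if_false, heven, Bool.false_eq_true, ← decide_not]

/-- **Value of the verdict** on the pair of final records. [cite: FortnowRogers1999JCSS, Lemma 3.2 and Thm. 3.1 (arXiv numbering)] -/
theorem verdictW_argT (s : Bool) : verdictW p s (argT F x w ex co₁ co₂ M₁ M₂) =
    [decide (true ∉ co₂) && (M₂.ok && (M₁.s.2.2 && (M₂.s.2.2 && (decide (M₁.s.1 = M₂.s.1) &&
      (headBit (List.ofFn M₁.s.1) && (clsAcc s ((M₁.s.2.1 + 7 * M₂.s.2.1) % 8) &&
        uTest (p.eval x.length - (M₁.hh + 1)) ((M₁.s.2.1 + 7 * M₂.s.2.1) % 8) (w.take (Kx p x))))))))] := by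
  obtain ⟨-, -, -, hw1, -, hvb1, -⟩ := fields_recOf (F.descFn x) [] co₁ M₁
  obtain ⟨-, -, hco2, hw2, -, hvb2, -, hok2, -⟩ := fields_recOf (F.descFn x) [] co₂ M₂
  have hpad : padT (argT F x w ex co₁ co₂ M₁ M₂) = [decide (true ∉ co₂)] := by
    rw [padT, notFn_apply (b := decide (true ∈ co₂))]
    · simp [decide_not]
    · simp only [Function.comp_apply, r2P, argT, sndF_boolPair, hco2, hasTrueFn_apply]
  have hok : ok2T (argT F x w ex co₁ co₂ M₁ M₂) = [M₂.ok] := by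
    rw [ok2T, eqC_apply]; simp only [Function.comp_apply, r2P, argT, sndF_boolPair, hok2]; cases M₂.ok <;> rfl
  have hv1 : vb1T (argT F x w ex co₁ co₂ M₁ M₂) = [M₁.s.2.2] := by
    rw [vb1T, eqC_apply]; simp only [Function.comp_apply, r1P, argT, fstF_boolPair, sndF_boolPair, hvb1]; cases M₁.s.2.2 <;> rfl
  have hv2 : vb2T (argT F x w ex co₁ co₂ M₁ M₂) = [M₂.s.2.2] := by
    rw [vb2T, eqC_apply]; simp only [Function.comp_apply, r2P, argT, sndF_boolPair, hvb2]; cases M₂.s.2.2 <;> rfl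
  have hlab : labT (argT F x w ex co₁ co₂ M₁ M₂) = [decide (M₁.s.1 = M₂.s.1)] := by
    simp only [labT, Function.comp_apply, fanoutFn_apply, r1P, r2P, argT, fstF_boolPair, sndF_boolPair, hw1, hw2,
      eqPairFn_boolPair, List.ofFn_inj]
  have hacc : accT (argT F x w ex co₁ co₂ M₁ M₂) = [headBit (List.ofFn M₁.s.1)] := by
    rw [accT, bitT_apply]; simp only [Function.comp_apply, r1P, argT, fstF_boolPair, sndF_boolPair, hw1]
  rw [verdictW, andFn_apply hpad (andFn_apply hok (andFn_apply hv1 (andFn_apply hv2 (andFn_apply hlab (andFn_apply hacc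
    (andFn_apply (clsT_argT F x w ex co₁ co₂ M₁ M₂ s) (uTT_argT p F x w ex co₁ co₂ M₁ M₂)))))))]

end VerdictSpec

/-! ### The evaluator language and the two relations -/

section Relation

variable (F : QCircuitFamily cliffordT) (p : Polynomial ℕ) (s : Bool)

/-- **The evaluator**: the verdict after both walks on the oracle's answer bits. [cite: LadnerLynchSelman1975, §3] -/
def dW : List Bool → List Bool := verdictW p s ∘ st2W F p exP (fun _ => [])

/-- **The evaluator language** `{T | dW T = 1}`. [cite: LadnerLynchSelman1975, §3] -/
def dLang : Language Bool := {T | dW F p s T = [true]}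

/-- **The relation of sign `s`**: the truth-table reduction with query generator `qryW F p`, `|z|`
queries and evaluator `dLang F p s`. [cite: FortnowRogers1999JCSS, Lemma 3.2 (arXiv numbering)] [cite: LadnerLynchSelman1975, §3] -/
def relW (A : Language Bool) : Language Bool := ttLang (qryW F p) X (dLang F p s) A

variable {F}

/-- `dW ∈ FP` for a uniform family. [folklore] -/
theorem dW_mem_FP (hU : F.IsUniform) : dW F p s ∈ FP :=
  comp_mem_FP (verdictW_mem_FP p s) (st2W_mem_FP p hU sndF_mem_FP (const_mem_FP _))

/-- **`dLang F p s ∈ P`** for a uniform family. [cite: AroraBarak2009, §1.3] -/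
theorem dLang_mem_P (hU : F.IsUniform) : dLang F p s ∈ Classes.P :=
  mem_P_of_mem_FP (dW_mem_FP p s hU) _ fun T =>
    ⟨fun h => h, fun h => by
      obtain ⟨b, hb⟩ := (oneBit_verdictW p s).comp (st2W F p exP (fun _ => [])) T
      cases b
      · exact hb
      · exact absurd hb h⟩

/-- **`relW F p s A ∈ P^A`** (truth-table reductions are Turing reductions). [cite: LadnerLynchSelman1975, §3] -/
theorem relW_mem_PRel (hU : F.IsUniform) (A : Language Bool) : relW F p s A ∈ PRel (Oracle.ofLanguage A) :=
  ttLang_mem_PRel (qryW_mem_FP p hU) (dLang_mem_P p s hU) A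

variable (F) (A : Language Bool) (x : List Bool)

/-- **The specification of the relation of sign `s`** on `⟨x, u y⟩` (`|u| = p(|x|) + 1`), for the
gate list `gs` of the `|x|`-th circuit, `μ` gates, start state `s₀ = (x0^m, 0, valid)`: the padding
coins `y ⇂ 4μ` are `0`, the guesses of both coin streams `y` and `y ⇂ 2μ` are consistent with `A`,
and the class datum of the two guessed walks is accepted with `u` passing its multiplicity test.
[cite: FortnowRogers1999JCSS, Lemma 3.2 (arXiv numbering)] -/
def relSpec (u y : List Bool) : Bool :=
  decide (true ∉ (y.drop (2 * (F.circ x.length).gates.length)).drop (2 * (F.circ x.length).gates.length)) &&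
    (gCons A (F.circ x.length).gates y (w₀ F x, 0, true) &&
      (gCons A (F.circ x.length).gates (y.drop (2 * (F.circ x.length).gates.length)) (w₀ F x, 0, true) &&
        (match clsO (gRun (F.circ x.length).gates y (w₀ F x, 0, true))
            (gRun (F.circ x.length).gates (y.drop (2 * (F.circ x.length).gates.length)) (w₀ F x, 0, true)) with
          | some d => clsAcc s d && uTest (p.eval x.length - (hCount (F.circ x.length).gates + 1)) d u
          | none => false)))

variable {F p s A x}

/-- **Membership in the relation is the specification.** On `z = ⟨x, u y⟩` with `|u| = p(|x|) + 1` and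
`|y| ≥ 4μ`, the oracle's answers to the `|z| ≥ 2μ` queries are, walk by walk, the answers to the
queries of the guessed walks, so the machine's consistency bits are `gCons` (`gConsE_answers`) and
the verdict is `relSpec`. [cite: FortnowRogers1999JCSS, Lemma 3.2 and §3 (arXiv numbering)] -/
theorem mem_relW_iff (u y : List Bool) (hu : u.length = Kx p x) (hy : 4 * (F.circ x.length).gates.length ≤ y.length) :
    boolPair x (u ++ y) ∈ relW F p s A ↔ relSpec F p s A x u y = true := by
  have hz : 2 * (F.circ x.length).gates.length ≤ (X : Polynomial ℕ).eval (boolPair x (u ++ y)).length := by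
    simp only [eval_X, length_boolPair, List.length_append]; omega
  obtain ⟨rest, hes⟩ := ttBits_qryW F p x A (u ++ y) hz
  have hyd : (u ++ y).drop (Kx p x) = y := by rw [← hu]; exact List.drop_left' rfl
  have hut : (u ++ y).take (Kx p x) = u := by rw [← hu]; exact List.take_left' rfl
  rw [hyd] at hes
  rw [relW, mem_ttLang_iff]
  show dW F p s (boolPair (boolPair x (u ++ y)) (ttBits (qryW F p) A (boolPair x (u ++ y)) _)) = [true] ↔ _
  generalize ttBits (qryW F p) A (boolPair x (u ++ y)) ((X : Polynomial ℕ).eval (boolPair x (u ++ y)).length) = es at hes ⊢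
  have h2 := st2W_apply F p x (u ++ y) es exP (fun _ => [])
  obtain ⟨-, -, hex, -⟩ := parse_apply F p x (u ++ y) es
  rw [hex, hyd] at h2
  rw [dW, Function.comp_apply, h2]
  simp only
  rw [show ∀ co₁ co₂ (M₁ M₂ : MS (x.length + F.ancillas x.length)),
      boolPair (boolPair (boolPair (boolPair x (u ++ y)) es) (recOf (F.descFn x) [] co₁ M₁)) (recOf (F.descFn x) [] co₂ M₂) =
        argT F x (u ++ y) es co₁ co₂ M₁ M₂ from fun _ _ _ _ => rfl, verdictW_argT, hut]
  simp only [mRun_s, mRun_ok, mRun_hh, mRun_an, m1, m2, Bool.true_and, zero_add, List.cons.injEq, and_true]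
  unfold relSpec
  generalize (F.circ x.length).gates = gs at hes hy ⊢
  -- the answers, walk by walk
  have hok1 : gConsE gs y es (w₀ F x, 0, true) = gCons A gs y (w₀ F x, 0, true) := by
    rw [hes, gConsE_answers]
  have hok2 : gConsE gs (y.drop (2 * gs.length)) (es.drop gs.length) (w₀ F x, 0, true) =
      gCons A gs (y.drop (2 * gs.length)) (w₀ F x, 0, true) := by
    rw [hes, List.drop_left' (by simp), gConsE_answers]
  rw [hok1, hok2]
  unfold clsO
  obtain ⟨⟨l₁, φ₁, v₁⟩, h1⟩ : ∃ r, gRun gs y (w₀ F x, 0, true) = r := ⟨_, rfl⟩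
  obtain ⟨⟨l₂, φ₂, v₂⟩, h2'⟩ : ∃ r, gRun gs (y.drop (2 * gs.length)) (w₀ F x, 0, true) = r := ⟨_, rfl⟩
  rw [h1, h2']
  simp only
  by_cases hc : v₁ = true ∧ v₂ = true ∧ l₁ = l₂ ∧ headBit (List.ofFn l₁) = true
  · obtain ⟨hv1, hv2, hl, hh⟩ := hc
    subst hv1 hv2 hl
    rw [if_pos ⟨rfl, rfl, rfl, hh⟩]
    simp [hh, Bool.and_assoc]
  · rw [if_neg hc]
    constructor
    · intro h
      simp only [Bool.and_eq_true, decide_eq_true_eq] at h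
      exact absurd ⟨h.2.2.1, h.2.2.2.1, h.2.2.2.2.1, h.2.2.2.2.2.1⟩ hc
    · intro h
      simp at h

end Relation

/-! ### Counting the witnesses -/

section Count

/-- **The counter block contributes the multiplicity**: summed over `u ∈ {0,1}^K` (`K ≥ k + 1`),
the indicator "class accepted and `u` passes the test of the class" is `pairTerm`. [folklore] -/
theorem sum_vector_uTest (s : Bool) (k K : ℕ) (hK : k + 1 ≤ K) (o : Option ℕ) :
    ∑ u : List.Vector Bool K,
        (if (match o with | some d => clsAcc s d && uTest k d u.toList | none => false) = true then (1 : ℤ) else 0) =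
      pairTerm s k o := by
  rcases o with _ | d
  · simp [pairTerm]
  · simp only [pairTerm]
    by_cases ha : clsAcc s d = true
    · simp only [ha, Bool.true_and, if_true]
      rw [sum_vector_ite K (uTest k d) 1, one_mul, cnt_uTest k d K hK]
    · simp [ha]


variable (F : QCircuitFamily cliffordT) (p : Polynomial ℕ) (A : Language Bool) (x : List Bool)

/-- **The witness count of the relation of sign `s`** as the weighted class count over pairs of
honest walks: with `μ` gates, `K = p(|x|)+1` counter bits and `P` padding coins, the witnesses
`w ∈ {0,1}^{K + 2μ + 2μ + P}` with `⟨x, w⟩ ∈ relW F p s A` number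
`Σ_{b, b' ∈ {0,1}^μ} pairTerm s k (clsO (oRun b) (oRun b'))`, `k = p(|x|) ∸ (h + 1)`.
[cite: FortnowRogers1999JCSS, Lemma 3.2 (arXiv numbering)] [cite: AdlemanDeMarraisHuang1997, §6 Lemma 6.10 (proof)] -/
theorem count_relW (s : Bool) (P : ℕ) :
    (cnt (Kx p x + (2 * (F.circ x.length).gates.length + (2 * (F.circ x.length).gates.length + P)))
        {w | boolPair x w ∈ relW F p s A} : ℤ) =
      ∑ b : List.Vector Bool (F.circ x.length).gates.length, ∑ b' : List.Vector Bool (F.circ x.length).gates.length,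
        pairTerm s (p.eval x.length - (hCount (F.circ x.length).gates + 1))
          (clsO (oRun A (F.circ x.length).gates b.toList (w₀ F x, 0, true))
            (oRun A (F.circ x.length).gates b'.toList (w₀ F x, 0, true))) := by
  set gs := (F.circ x.length).gates with hgs
  set μ := gs.length with hμ
  set k := p.eval x.length - (hCount gs + 1) with hk
  set s₀ : TState (x.length + F.ancillas x.length) := (w₀ F x, 0, true) with hs₀
  have hgl : gs.length = (F.circ x.length).gates.length := by rw [hgs]
  have hK : k + 1 ≤ Kx p x := by simp only [hk, Kx]; omega
  -- split the witness into its four blocks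
  have step : (cnt (Kx p x + (2 * μ + (2 * μ + P))) {w | boolPair x w ∈ relW F p s A} : ℤ) =
      ∑ u : List.Vector Bool (Kx p x), ∑ y₁ : List.Vector Bool (2 * μ), ∑ y₂ : List.Vector Bool (2 * μ),
        if (gCons A gs y₁.toList s₀ && (gCons A gs y₂.toList s₀ &&
          (match clsO (gRun gs y₁.toList s₀) (gRun gs y₂.toList s₀) with
            | some d => clsAcc s d && uTest k d u.toList
            | none => false))) = true then (1 : ℤ) else 0 := by
    rw [cnt_add_eq_sum]
    push_cast
    refine Finset.sum_congr rfl fun u _ => ?_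
    rw [cnt_add_eq_sum]
    push_cast
    refine Finset.sum_congr rfl fun y₁ _ => ?_
    rw [cnt_add_eq_sum]
    push_cast
    refine Finset.sum_congr rfl fun y₂ _ => ?_
    have hiff : ∀ v : List Bool, (y₂.toList ++ v ∈ {v | y₁.toList ++ v ∈ {v | u.toList ++ v ∈ {w | boolPair x w ∈ relW F p s A}}}) ↔
        (true ∉ v ∧ (gCons A gs y₁.toList s₀ && (gCons A gs y₂.toList s₀ &&
          (match clsO (gRun gs y₁.toList s₀) (gRun gs y₂.toList s₀) with
            | some d => clsAcc s d && uTest k d u.toList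
            | none => false))) = true) := by
      intro v
      simp only [Set.mem_setOf_eq]
      rw [mem_relW_iff u.toList _ (by simp) (by simp only [List.length_append, List.Vector.toList_length]; omega), relSpec]
      have e1 : (y₁.toList ++ (y₂.toList ++ v)).drop (2 * μ) = y₂.toList ++ v := by
        rw [List.drop_append_of_le_length (by simp [hμ]), List.drop_of_length_le (by simp [hμ]), List.nil_append]
      have e2 : (y₂.toList ++ v).drop (2 * μ) = v := by
        rw [List.drop_append_of_le_length (by simp [hμ]), List.drop_of_length_le (by simp [hμ]), List.nil_append]
      rw [← hgs, e1, e2, gCons_append A gs y₁.toList _ s₀ (by simp [hμ]), gCons_append A gs y₂.toList _ s₀ (by simp [hμ]),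
        gRun_append gs y₁.toList _ s₀ (by simp [hμ]), gRun_append gs y₂.toList _ s₀ (by simp [hμ])]
      simp only [Bool.and_eq_true, decide_eq_true_eq, ← hk]
    rw [show {v : List Bool | y₂.toList ++ v ∈ {v | y₁.toList ++ v ∈ {v | u.toList ++ v ∈ {w | boolPair x w ∈ relW F p s A}}}} =
        {v | true ∉ v ∧ _} from Set.ext hiff, cnt_noTrue_and]
  rw [step, Finset.sum_comm]
  refine (Finset.sum_congr rfl fun y₁ _ => Finset.sum_comm).trans ?_
  -- the counter block: multiplicities
  have inner : ∀ y₁ y₂ : List.Vector Bool (2 * μ),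
      (∑ u : List.Vector Bool (Kx p x),
        if (gCons A gs y₁.toList s₀ && (gCons A gs y₂.toList s₀ &&
          (match clsO (gRun gs y₁.toList s₀) (gRun gs y₂.toList s₀) with
            | some d => clsAcc s d && uTest k d u.toList
            | none => false))) = true then (1 : ℤ) else 0) =
      if gCons A gs y₁.toList s₀ = true then
        (if gCons A gs y₂.toList s₀ = true then pairTerm s k (clsO (gRun gs y₁.toList s₀) (gRun gs y₂.toList s₀)) else 0)
      else 0 := by
    intro y₁ y₂
    by_cases h1 : gCons A gs y₁.toList s₀ = true
    · by_cases h2 : gCons A gs y₂.toList s₀ = true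
      · rw [if_pos h1, if_pos h2, ← sum_vector_uTest s k (Kx p x) hK]
        exact Finset.sum_congr rfl fun u _ => by simp [h1, h2]
      · rw [if_pos h1, if_neg h2]
        exact Finset.sum_eq_zero fun u _ => by simp [h2]
    · rw [if_neg h1]
      exact Finset.sum_eq_zero fun u _ => by simp [h1]
  simp only [inner]
  -- one consistent guess vector per choice vector, twice
  have outer : ∀ y₁ : List.Vector Bool (2 * μ),
      (∑ y₂ : List.Vector Bool (2 * μ), if gCons A gs y₁.toList s₀ = true then
          (if gCons A gs y₂.toList s₀ = true then pairTerm s k (clsO (gRun gs y₁.toList s₀) (gRun gs y₂.toList s₀)) else 0)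
        else 0) =
      if gCons A gs y₁.toList s₀ = true then
        ∑ b' : List.Vector Bool μ, pairTerm s k (clsO (gRun gs y₁.toList s₀) (oRun A gs b'.toList s₀)) else 0 := by
    intro y₁
    split_ifs with h1
    · exact sum_gCons A gs (2 * μ) rfl (fun r => pairTerm s k (clsO (gRun gs y₁.toList s₀) r)) s₀
    · simp
  simp only [outer]
  exact sum_gCons A gs (2 * μ) rfl (fun r => ∑ b' : List.Vector Bool μ, pairTerm s k (clsO r (oRun A gs b'.toList s₀))) s₀

/-- The Hadamard count of a constantly annotated gate list. [folklore] -/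
theorem annHCount_map_const (gs : List (QGate cliffordT N)) : annHCount (gs.map fun g => (g, A)) = hCount gs := by
  unfold annHCount
  rw [List.map_map]
  congr 1
  exact List.map_id' gs

/-- **`accGap` is the difference of the two witness counts.** [cite: FortnowRogers1999JCSS, Lemma 3.2 and Thm. 3.1 (arXiv numbering)] -/
theorem accGap_eq_count_sub (P : ℕ) :
    accGap F A (fun n => p.eval n) x =
      (cnt (Kx p x + (2 * (F.circ x.length).gates.length + (2 * (F.circ x.length).gates.length + P)))
          {w | boolPair x w ∈ relW F p true A} : ℤ) -
        (cnt (Kx p x + (2 * (F.circ x.length).gates.length + (2 * (F.circ x.length).gates.length + P)))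
          {w | boolPair x w ∈ relW F p false A} : ℤ) := by
  rw [count_relW, count_relW, sum_pairTerm_sub]
  unfold accGap accA accB accH accGas accInput w₀
  rw [annHCount_map_const]

variable {F} in
/-- **`accGap F A p ∈ GapP^A`** for a uniform family: the two `#P^A` functions are the witness counts
of `relW F p true A` and `relW F p false A` (`∈ P^A`), with the witness polynomial `(p + 1) + 2c` for
a coin polynomial `c ≥ 2μ + 3` of the family. [cite: FortnowRogers1999JCSS, Lemma 3.2, Thm. 3.1 and §3 ("Theorem 3.1 relativizes") (arXiv numbering)] -/
theorem accGap_mem_GapPRel (hU : F.IsUniform) : accGap F A (fun n => p.eval n) ∈ GapPRel (Oracle.ofLanguage A) := by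
  obtain ⟨c, hc⟩ := exists_coinPoly (F := F) hU
  refine ⟨fun x => countWitnesses (relW F p true A) (((p + 1) + 2 * c).eval x.length) x,
    ⟨relW F p true A, relW_mem_PRel p true hU A, (p + 1) + 2 * c, fun x => rfl⟩,
    fun x => countWitnesses (relW F p false A) (((p + 1) + 2 * c).eval x.length) x,
    ⟨relW F p false A, relW_mem_PRel p false hU A, (p + 1) + 2 * c, fun x => rfl⟩, fun x => ?_⟩
  obtain ⟨P, hP⟩ : ∃ P, ((p + 1) + 2 * c).eval x.length =
      Kx p x + (2 * (F.circ x.length).gates.length + (2 * (F.circ x.length).gates.length + P)) :=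
    ⟨2 * c.eval x.length - 4 * (F.circ x.length).gates.length, by
      have := hc x.length
      simp only [eval_add, eval_mul, eval_one, eval_ofNat, Kx]
      omega⟩
  simp only
  rw [PPSharpP.countWitnesses_eq_cnt, PPSharpP.countWitnesses_eq_cnt, hP]
  exact accGap_eq_count_sub F p A x P

end Count

end ADH

/-! ### The named facts -/

/-- **Fortnow–Rogers 1999, Thm. 3.1, relativized: `BQP^A ⊆ AWPP^A` for every oracle `A`** —
discharge of the named fact `BQPRel_subset_AWPPRel` (`CountingSimulationRel.lean`).
[cite: FortnowRogers1999JCSS, Thm. 3.1, Lemma 3.2 and §3 before Cor. 3.7 (arXiv numbering)] -/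
theorem BQPRel_subset_AWPPRel_holds : BQPRel_subset_AWPPRel :=
  BQPRel_subset_AWPPRel_of_accGap fun _ A p hU => ADH.accGap_mem_GapPRel p A hU

/-- **Fortnow–Rogers 1999, Thm. 3.1: `BQP ⊆ AWPP`**, once more — the relativized theorem at the
empty oracle (`BQP_subset_AWPP_of_accGap`). The named fact `BQP_subset_AWPP` is ALREADY discharged
in the tree by a different route (`BQP_subset_AWPP_holds`, `BQPSubsetAWPP.lean`: one `GapP`
function through the amplifying cubic); this is the consistency check that the oracle-walk count
gives it too. [cite: FortnowRogers1999JCSS, Thm. 3.1 (arXiv numbering)] -/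
theorem BQP_subset_AWPP_via_oracleWalk : BQP_subset_AWPP :=
  BQP_subset_AWPP_of_accGap fun _ A p hU => ADH.accGap_mem_GapPRel p A hU

end Literature.Computability.QuantumComplexity

end
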